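import Summits.ResolutionOfSingularities.ResolutionOfSingularities.Theorems.FreezeCutHalf
import Summits.ResolutionOfSingularities.ResolutionOfSingularities.Theorems.FreezeCutClasses
import Summits.ResolutionOfSingularities.ResolutionOfSingularities.Theorems.MaxContactCutShadeCut
import HarnessLib

/-!
# MaxContactCutFreezeCut — decomp-res node «FreezeCut» (lens-3 g19 rev 2, critic rows 149/149a/149b), tree file
5/5 of the node

Content VERBATIM from the decomp-res lens-3 g19 TREE-FACING COMPANION
`HOME/decomp-res-lens-3/g19/tree/FreezeCutTree.lean` (rev 3 pin
7e31fb5a…; = node `FreezeCut.lean` rev 2 pin c7927053 NEW PART ONLY; HOME = run/shared/lean/pub/decomp-res).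
Critic: CRITIC-LEDGER rows 149 / 149a /
149b CLEARED (orders 2026-08-30T22:14:37Z / 22:25:58Z / 22:27:55Z).  Landed by decomp-res writer g8 as five files
— `FreezeCutConeVars` (§V),
`FreezeCutLaw` (§F), `FreezeCutHalf` (§H) [namespace `…Theorems.HoleCut`, in-cone behind
`MaxContactCutHoleCut`], `FreezeCutClasses` (cone-free
classes of §K5/§K6; carries the full landing note and the companion description) and the wiring file
`MaxContactCutFreezeCut` — all
`--supports stmt-ResolutionOfSingularities-31770`.

IN-CONE WIRING of §K5/§K6: the booking theorems over the freezing laws and the MaxContactCut asides BY NAME —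
`noSupercriticalJointTails_holds`,
`noHoleFillingTails_holds` (piece B of 28532 / HoleCut EMPTIED IN KERNEL), `four_iff_sub`, `defectWalksDeep_iff_sub`
(31770 ≡ deep arc law ∧ piece A),
the cross-axis law `defectWalksDeep_iff_subPlanar_subSkew`, `noLowJointTails_holds`,
`defectWalksDeep_iff_highPlanar_highSkew`, … .  0 sorry.
Imports `FreezeCutHalf` + `FreezeCutClasses`; namespace `…Theorems.FreezeCut` with `open …Theorems.HoleCut` (as
the companion).  The companion's §M
`closes` (tree `MaxContactCutExponentLadder.closes` verbatim) is omitted; the companion's private copy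
`four_le_prime_pow` is replaced by the
landed `ShadeCut.four_le_pow` (dedup).

[WRITER NOTE (decomp-res writer g8): section split only; namespaces, opens, section variables and every declaration
exactly as in the
companion (its global `linter.dupNamespace` option line dropped).]

(Sources: Hauser2010; Moh1987; CossartPiltant2008I; BenitoVillamayor2012; KawanoueMatsuki2010; HironakaBowdoin2005.)
-/

noncomputable section

open MvPolynomial Finset
open Literature.AlgebraicGeometry.Resolution
open Literature.AlgebraicGeometry.Resolution.Hauser2010
open Literature.AlgebraicGeometry.Resolution.PointBlowup
open Summit.ResolutionOfSingularities.ResolutionOfSingularities.Theses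
open Summit.ResolutionOfSingularities.ResolutionOfSingularities.Theorems.TightDefectClasses
open Summit.ResolutionOfSingularities.ResolutionOfSingularities.Theorems.TightDefectStrongWalks
open Summit.ResolutionOfSingularities.ResolutionOfSingularities.Theorems.ItineraryCutClasses
open Summit.ResolutionOfSingularities.ResolutionOfSingularities.Theorems.BoundaryLedger
open Summit.ResolutionOfSingularities.ResolutionOfSingularities.Theorems.ProximityCut
open Summit.ResolutionOfSingularities.ResolutionOfSingularities.Theorems.ConeCutAxisLaw
open Literature.AlgebraicGeometry.Resolution.WeightedBlowup
open Literature.Barriers.ResolutionOfSingularities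
open Summit.ResolutionOfSingularities.ResolutionOfSingularities.Theorems.FloorCut
open Summit.ResolutionOfSingularities.ResolutionOfSingularities.Theorems.ConeCut
open Summit.ResolutionOfSingularities.ResolutionOfSingularities.Theorems.ExitLaw (fin3_cases eq_of_le_of_degree_le)
open Summit.ResolutionOfSingularities.ResolutionOfSingularities.Theorems.ShadeCut
open Summit.ResolutionOfSingularities.ResolutionOfSingularities.Theorems.TightCut
open Summit.ResolutionOfSingularities.ResolutionOfSingularities.Theorems.HoleCut

namespace Summit.ResolutionOfSingularities.ResolutionOfSingularities.Theorems.FreezeCut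

/-! ## §K5 BOOKING (g19) — PIECE B EMPTIED IN KERNEL; THE RESIDUAL IS «SUBCRITICAL JOINT TAILS»; THE CROSS-AXIS LAW
WITH LENS-5 (PLANAR and SKEW joint tails are SUBCRITICAL).

`noSupercriticalJointTails_holds` (THE DECIDED WINDOW: ALL supercritical joint tails, `3s ≤ p^e + 2`, every shade
`s ≥ 1` at once, HYPOTHESIS-FREE) ⊇ by letter g18's piece B (`noHoleFillingTails_holds`) and g18's hole-free window.
EXACT: the tree's joint residual ≡ g18's piece A ALONE (`joint_iff_sub`); 31770 ≡ deep arc law ∧ piece A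
(`defectWalksDeep_iff_sub`, THE ONE CERTIFIED EQUIVALENCE OF THIS NODE).  CROSS-AXIS (criticality × lens-5's
planar/skew letters, load-bearing): lens-5's planar window ≡ its subcritical part, lens-5's skew residual ≡ its
subcritical part (`planar_iff_subPlanar`, `skew_iff_subSkew`), and piece A ≡ subcritical-planar ∧ subcritical-skew
(`sub_iff_subPlanar_subSkew`); composed: `defectWalksDeep_iff_subPlanar_subSkew`. -/

section BookingFreeze

/-- **THE SUPERCRITICAL WINDOW IS EMPTY (PROVED, hypothesis-free, every shade at once).** [new] [folklore] -/
theorem noSupercriticalJointTails_holds : NoSupercriticalJointTailsDeep := by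
  intro p hp e he K _ _ _ _ s₀ hs W hW N hN hex hrec htr s hsN hq
  have h1 := hW N
  rw [hsN] at h1
  have hs1 : 1 ≤ s := by exact_mod_cast h1
  exact TailShade.no_joint hs hq hs1 ⟨hN, hsN, hex⟩ hrec htr

/-- The decided window is WEAKER than the joint residual by letter. [folklore] -/
theorem supercritical_of_joint (h : ExitLaw.NoRepeatTranslationRecurrentExcessPlateauxDeep) :
    NoSupercriticalJointTailsDeep :=
  fun p hp e he K _ _ _ _ s₀ hs W hW N hN hex hrec htr _ _ _ => h p hp e he K s₀ hs W hW N hN hex hrec htr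

/-- **g18's PIECE B IS EMPTY (PROVED, hypothesis-free)**: there are no supercritical hole-filling tails — indeed no
supercritical joint tails at all. [new] [folklore] -/
theorem noHoleFillingTails_holds : NoHoleFillingTailsDeep :=
  fun p hp e he K _ _ _ _ s₀ hs W hW N hN hex hrec htr s hsN _ hsup _ =>
    noSupercriticalJointTails_holds p hp e he K s₀ hs W hW N hN hex hrec htr s hsN hsup

/-- **SUFFICIENCY OF PIECE A ALONE (PROVED)**: subcritical joint tails ⇒ the tree's joint residual. [new] [folklore] -/
theorem joint_of_sub (hA : NoSubcriticalJointTailsDeep) : ExitLaw.NoRepeatTranslationRecurrentExcessPlateauxDeep :=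
  joint_iff_hole.mpr ⟨hA, noHoleFillingTails_holds⟩

/-- **EXACT (PROVED, hypothesis-free): THE TREE's JOINT RESIDUAL IS «SUBCRITICAL JOINT TAILS»** — joint tails of
shade `s ≥ 3` at a modulus `p^e ≤ 3s − 3`. [new] [folklore] -/
theorem joint_iff_sub : ExitLaw.NoRepeatTranslationRecurrentExcessPlateauxDeep ↔ NoSubcriticalJointTailsDeep :=
  ⟨fun h => (joint_iff_hole.mp h).1, joint_of_sub⟩

/-- EXACT, composed: g17's located residual is piece A. [new] [folklore] -/
theorem four_iff_sub : NoJointTailsFromFourDeep ↔ NoSubcriticalJointTailsDeep :=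
  joint_iff_four.symm.trans joint_iff_sub

/-- **KERNEL BY NAME (aside 31770)**: deep arc law ∧ subcritical joint tails ⇒ `MaxContactCut.DefectWalksDeep`.
[new] [folklore] -/
theorem defectWalksDeep_of_sub (hA : NoFreePointTailsDeep) (hS : NoSubcriticalJointTailsDeep) :
    MaxContactCut.DefectWalksDeep :=
  defectWalksDeep_of_hole hA hS noHoleFillingTails_holds

/-- **THE ONE CERTIFIED EQUIVALENCE OF THIS NODE (PROVED, EXACT, hypothesis-free)**:
`MaxContactCut.DefectWalksDeep ↔ deep arc law ∧ SUBCRITICAL joint tails`. [new] [folklore] -/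
theorem defectWalksDeep_iff_sub :
    MaxContactCut.DefectWalksDeep ↔ NoFreePointTailsDeep ∧ NoSubcriticalJointTailsDeep := by
  rw [defectWalksDeep_iff_hole]
  exact ⟨fun h => ⟨h.1, h.2.1⟩, fun h => ⟨h.1, h.2, noHoleFillingTails_holds⟩⟩

/-! ### The cross-axis law with lens-5 (criticality × planar/skew) -/

/-- **THE CROSS-AXIS LAW, planar side (PROVED): A PLANAR JOINT TAIL IS SUBCRITICAL** — lens-5's planar window IS
its subcritical part. [new] [folklore] -/
theorem planar_of_subPlanar (h : NoSubcriticalPlanarJointTailsDeep) : CoefficientCut.NoPlanarJointTailsDeep := by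
  intro p hp e he K _ _ _ _ s₀ hs W hW N hN hex hrec htr k N' hP
  classical
  obtain ⟨o, ho, -⟩ := walk_nat hs W N
  obtain ⟨s, hsN, -⟩ := order_eq_shade_add_degree hs W N ho
  have hq4 := ShadeCut.four_le_pow hp he
  by_cases hsup : 3 * s ≤ p ^ e + 2
  · exact noSupercriticalJointTails_holds p hp e he K s₀ hs W hW N hN hex hrec htr s hsN hsup
  · exact h p hp e he K s₀ hs W hW N hN hex hrec htr s hsN (by omega) (by omega) k N' hP

/-- **EXACT (PROVED)**: lens-5's planar window ≡ subcritical planar joint tails. [new] [folklore] -/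
theorem planar_iff_subPlanar : CoefficientCut.NoPlanarJointTailsDeep ↔ NoSubcriticalPlanarJointTailsDeep :=
  ⟨subPlanar_of_planar, planar_of_subPlanar⟩

/-- **THE CROSS-AXIS LAW, skew side (PROVED): A SKEW JOINT TAIL IS SUBCRITICAL** — lens-5's skew residual IS its
subcritical part. [new] [folklore] -/
theorem skew_of_subSkew (h : NoSubcriticalSkewJointTailsDeep) : CoefficientCut.NoSkewJointTailsDeep := by
  intro p hp e he K _ _ _ _ s₀ hs W hW N hN hex hrec htr hsk
  classical
  obtain ⟨o, ho, -⟩ := walk_nat hs W N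
  obtain ⟨s, hsN, -⟩ := order_eq_shade_add_degree hs W N ho
  have hq4 := ShadeCut.four_le_pow hp he
  by_cases hsup : 3 * s ≤ p ^ e + 2
  · exact noSupercriticalJointTails_holds p hp e he K s₀ hs W hW N hN hex hrec htr s hsN hsup
  · exact h p hp e he K s₀ hs W hW N hN hex hrec htr s hsN (by omega) (by omega) hsk

/-- **EXACT (PROVED)**: lens-5's skew residual ≡ subcritical skew joint tails. [new] [folklore] -/
theorem skew_iff_subSkew : CoefficientCut.NoSkewJointTailsDeep ↔ NoSubcriticalSkewJointTailsDeep :=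
  ⟨subSkew_of_skew, skew_of_subSkew⟩

/-- **EXACT, THE COMBINED BOOKING OF THE JOINT RESIDUAL AFTER lens-3 g19 AND lens-5 (PROVED, hypothesis-free)**:
`ExitLaw.NoRepeatTranslationRecurrentExcessPlateauxDeep ↔ subcritical-planar ∧ subcritical-skew`. [new] [folklore] -/
theorem joint_iff_subPlanar_subSkew :
    ExitLaw.NoRepeatTranslationRecurrentExcessPlateauxDeep ↔
      NoSubcriticalPlanarJointTailsDeep ∧ NoSubcriticalSkewJointTailsDeep :=
  joint_iff_sub.trans sub_iff_subPlanar_subSkew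

/-- The same in lens-5's own letters (PROVED, hypothesis-free): the joint residual ≡ lens-5's planar window ∧ lens-5's
skew residual, each of which IS its subcritical part. [new] [folklore] -/
theorem joint_iff_planar_skew :
    ExitLaw.NoRepeatTranslationRecurrentExcessPlateauxDeep ↔
      CoefficientCut.NoPlanarJointTailsDeep ∧ CoefficientCut.NoSkewJointTailsDeep := by
  rw [joint_iff_subPlanar_subSkew, planar_iff_subPlanar, skew_iff_subSkew]

/-- **KERNEL BY NAME (aside 31770), split form**: deep arc law ∧ subcritical-planar ∧ subcritical-skew ⇒
`MaxContactCut.DefectWalksDeep`. [new] [folklore] -/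
theorem defectWalksDeep_of_subPlanar_subSkew (hA : NoFreePointTailsDeep) (h₁ : NoSubcriticalPlanarJointTailsDeep)
    (h₂ : NoSubcriticalSkewJointTailsDeep) : MaxContactCut.DefectWalksDeep :=
  defectWalksDeep_of_sub hA (sub_of_subPlanar_subSkew h₁ h₂)

/-- EXACT, split form (PROVED, hypothesis-free): `MaxContactCut.DefectWalksDeep ↔ deep arc law ∧ subcritical-planar ∧
subcritical-skew`. [new] [folklore] -/
theorem defectWalksDeep_iff_subPlanar_subSkew :
    MaxContactCut.DefectWalksDeep ↔
      NoFreePointTailsDeep ∧ NoSubcriticalPlanarJointTailsDeep ∧ NoSubcriticalSkewJointTailsDeep := by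
  rw [defectWalksDeep_iff_sub, sub_iff_subPlanar_subSkew]

/-- MODULO lens-5's port (its planar window as a hypothesis), 31770 ≡ deep arc law ∧ subcritical SKEW joint tails
(PROVED). [new] [folklore] -/
theorem defectWalksDeep_iff_subSkew_of_planar (hP : CoefficientCut.NoPlanarJointTailsDeep) :
    MaxContactCut.DefectWalksDeep ↔ NoFreePointTailsDeep ∧ NoSubcriticalSkewJointTailsDeep := by
  rw [defectWalksDeep_iff_subPlanar_subSkew]
  exact ⟨fun h => ⟨h.1, h.2.2⟩, fun h => ⟨h.1, subPlanar_of_planar hP, h.2⟩⟩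

/-- Necessity of the located residual A₂ for 31770. [folklore] -/
theorem subSkew_of_defectWalksDeep (h : MaxContactCut.DefectWalksDeep) : NoSubcriticalSkewJointTailsDeep :=
  (defectWalksDeep_iff_subPlanar_subSkew.mp h).2.2

/-- Necessity of A₁ for 31770. [folklore] -/
theorem subPlanar_of_defectWalksDeep (h : MaxContactCut.DefectWalksDeep) : NoSubcriticalPlanarJointTailsDeep :=
  (defectWalksDeep_iff_subPlanar_subSkew.mp h).2.1

end BookingFreeze

/-! ## §K6 BOOKING OF THE HALF-CRITICAL LAW (g19 rev 2) — THE LOW-SHADE WINDOW `2s ≤ p^e` IS EMPTY; THE RESIDUAL IS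
«HIGH-SHADE SKEW JOINT TAILS» (`2s ≥ p^e + 1`: the residual cone has degree MORE THAN HALF the modulus)

`noLowJointTails_holds` (DECIDED, hypothesis-free, every shade: no joint tails with `2s ≤ p^e`) ⊇ by letter the
supercritical window of §K5.  EXACT re-locations one level down: A₁ ≡ A₁⁺ (`subPlanar_iff_highPlanar`),
A₂ ≡ A₂⁺
(`subSkew_iff_highSkew`), lens-5's classes likewise (`planar_iff_highPlanar`, `skew_iff_highSkew`), the joint
residual ≡ A₁⁺ ∧ A₂⁺ (`joint_iff_highPlanar_highSkew`), 31770 ≡ deep arc law ∧ A₁⁺ ∧ A₂⁺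
(`defectWalksDeep_iff_highPlanar_highSkew`). -/

section BookingHalf

/-- **THE LOW-SHADE WINDOW IS EMPTY (PROVED, hypothesis-free, every shade at once).** [new] [folklore] -/
theorem noLowJointTails_holds : NoLowJointTailsDeep := by
  intro p hp e he K _ _ _ _ s₀ hs W hW N hN hex hrec htr s hsN hq
  have h1 := hW N
  rw [hsN] at h1
  have hs1 : 1 ≤ s := by exact_mod_cast h1
  exact TailShade.no_joint' hs hq hs1 ⟨hN, hsN, hex⟩ hrec htr

/-- The decided low-shade window is WEAKER than the joint residual by letter. [folklore] -/
theorem low_of_joint (h : ExitLaw.NoRepeatTranslationRecurrentExcessPlateauxDeep) : NoLowJointTailsDeep :=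
  fun p hp e he K _ _ _ _ s₀ hs W hW N hN hex hrec htr _ _ _ => h p hp e he K s₀ hs W hW N hN hex hrec htr

/-- The supercritical window of §K5 is the low-shade window's sub-window by letter (`3s ≤ q + 2 ⇒ 2s ≤ q` for
`s ≥ 2`; `s = 1` needs `q ≥ 2`). [folklore] -/
theorem supercritical_of_low (h : NoLowJointTailsDeep) : NoSupercriticalJointTailsDeep := by
  intro p hp e he K _ _ _ _ s₀ hs W hW N hN hex hrec htr s hsN hsup
  have hq4 := ShadeCut.four_le_pow hp he
  exact h p hp e he K s₀ hs W hW N hN hex hrec htr s hsN (by omega)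

/-- **THE HALF-CRITICAL CUT, planar side (PROVED): a planar joint tail has `2s ≥ p^e + 1`.** [new] [folklore] -/
theorem subPlanar_of_highPlanar (h : NoHighPlanarJointTailsDeep) : NoSubcriticalPlanarJointTailsDeep := by
  intro p hp e he K _ _ _ _ s₀ hs W hW N hN hex hrec htr s hsN h3 hsub k N' hP
  by_cases hlow : 2 * s ≤ p ^ e
  · exact noLowJointTails_holds p hp e he K s₀ hs W hW N hN hex hrec htr s hsN hlow
  · exact h p hp e he K s₀ hs W hW N hN hex hrec htr s hsN h3 hsub (by omega) k N' hP

/-- **THE HALF-CRITICAL CUT, skew side (PROVED): a skew joint tail has `2s ≥ p^e + 1`.** [new] [folklore] -/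
theorem subSkew_of_highSkew (h : NoHighSkewJointTailsDeep) : NoSubcriticalSkewJointTailsDeep := by
  intro p hp e he K _ _ _ _ s₀ hs W hW N hN hex hrec htr s hsN h3 hsub hsk
  by_cases hlow : 2 * s ≤ p ^ e
  · exact noLowJointTails_holds p hp e he K s₀ hs W hW N hN hex hrec htr s hsN hlow
  · exact h p hp e he K s₀ hs W hW N hN hex hrec htr s hsN h3 hsub (by omega) hsk

/-- **EXACT (PROVED)**: A₁ ≡ A₁⁺. [new] [folklore] -/
theorem subPlanar_iff_highPlanar : NoSubcriticalPlanarJointTailsDeep ↔ NoHighPlanarJointTailsDeep :=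
  ⟨highPlanar_of_subPlanar, subPlanar_of_highPlanar⟩

/-- **EXACT (PROVED)**: A₂ ≡ A₂⁺ — the located residual of both lenses is «high-shade skew joint tails».
[new] [folklore] -/
theorem subSkew_iff_highSkew : NoSubcriticalSkewJointTailsDeep ↔ NoHighSkewJointTailsDeep :=
  ⟨highSkew_of_subSkew, subSkew_of_highSkew⟩

/-- **EXACT (PROVED)**: lens-5's planar window ≡ high-shade planar joint tails. [new] [folklore] -/
theorem planar_iff_highPlanar : CoefficientCut.NoPlanarJointTailsDeep ↔ NoHighPlanarJointTailsDeep :=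
  planar_iff_subPlanar.trans subPlanar_iff_highPlanar

/-- **EXACT (PROVED)**: lens-5's skew residual ≡ high-shade skew joint tails. [new] [folklore] -/
theorem skew_iff_highSkew : CoefficientCut.NoSkewJointTailsDeep ↔ NoHighSkewJointTailsDeep :=
  skew_iff_subSkew.trans subSkew_iff_highSkew

/-- **EXACT (PROVED)**: piece A ≡ A₁⁺ ∧ A₂⁺. [new] [folklore] -/
theorem sub_iff_highPlanar_highSkew :
    NoSubcriticalJointTailsDeep ↔ NoHighPlanarJointTailsDeep ∧ NoHighSkewJointTailsDeep := by
  rw [sub_iff_subPlanar_subSkew, subPlanar_iff_highPlanar, subSkew_iff_highSkew]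

/-- **EXACT, THE COMBINED BOOKING OF THE JOINT RESIDUAL AFTER g19 rev 2 (PROVED, hypothesis-free)**: the tree's
joint residual ≡ high-shade planar ∧ high-shade skew. [new] [folklore] -/
theorem joint_iff_highPlanar_highSkew :
    ExitLaw.NoRepeatTranslationRecurrentExcessPlateauxDeep ↔
      NoHighPlanarJointTailsDeep ∧ NoHighSkewJointTailsDeep :=
  joint_iff_sub.trans sub_iff_highPlanar_highSkew

/-- **KERNEL BY NAME (aside 31770), rev-2 split form**: deep arc law ∧ A₁⁺ ∧ A₂⁺ ⇒
`MaxContactCut.DefectWalksDeep`.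
[new] [folklore] -/
theorem defectWalksDeep_of_highPlanar_highSkew (hA : NoFreePointTailsDeep) (h₁ : NoHighPlanarJointTailsDeep)
    (h₂ : NoHighSkewJointTailsDeep) : MaxContactCut.DefectWalksDeep :=
  defectWalksDeep_of_sub hA (sub_iff_highPlanar_highSkew.mpr ⟨h₁, h₂⟩)

/-- EXACT, rev-2 split form (PROVED, hypothesis-free): `MaxContactCut.DefectWalksDeep ↔ deep arc law ∧ A₁⁺ ∧ A₂⁺`.
[new] [folklore] -/
theorem defectWalksDeep_iff_highPlanar_highSkew :
    MaxContactCut.DefectWalksDeep ↔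
      NoFreePointTailsDeep ∧ NoHighPlanarJointTailsDeep ∧ NoHighSkewJointTailsDeep := by
  rw [defectWalksDeep_iff_sub, sub_iff_highPlanar_highSkew]

/-- MODULO lens-5's port, 31770 ≡ deep arc law ∧ HIGH-SHADE SKEW joint tails (PROVED). [new] [folklore] -/
theorem defectWalksDeep_iff_highSkew_of_planar (hP : CoefficientCut.NoPlanarJointTailsDeep) :
    MaxContactCut.DefectWalksDeep ↔ NoFreePointTailsDeep ∧ NoHighSkewJointTailsDeep := by
  rw [defectWalksDeep_iff_highPlanar_highSkew]
  exact ⟨fun h => ⟨h.1, h.2.2⟩, fun h => ⟨h.1, planar_iff_highPlanar.mp hP, h.2⟩⟩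

/-- Necessity of the located residual A₂⁺ for 31770. [folklore] -/
theorem highSkew_of_defectWalksDeep (h : MaxContactCut.DefectWalksDeep) : NoHighSkewJointTailsDeep :=
  (defectWalksDeep_iff_highPlanar_highSkew.mp h).2.2

end BookingHalf

end Summit.ResolutionOfSingularities.ResolutionOfSingularities.Theorems.FreezeCut
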